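import Mathlib
import HarnessLib
import Summits.KontsevichZagierPeriods.KontsevichZagierPeriods.Theorems.SoloInformedSawtoothFunctional

/-!
# SoloInformed — the distribution relation of the sawtooth, annihilation of the standard lattice `L_N`,
and inflation compatibility `λ_m ∘ infl_d^n = λ_{m mod d}` (level-free kernel, part 2 of 2)

Continuation of `SoloInformedSawtoothFunctional` (paper/main.md §7 (c6)(ix), solo-informed):

* GAUSS'S DISTRIBUTION RELATION for the sawtooth, of every index `d = N/M`
  (`soloInformed_saw_distribution`: `Σ_{x ≡ y (mod M)} ((x/N)) = ((d·y/N))`, via the explicit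
  parametrisation `soloInformed_fiber_eq` of a residue class);
* hence a unit sawtooth functional `λ_m` annihilates every distribution vector
  `1_{x ≡ y (M)} - e_{(N/M)y}` (`soloInformed_sawFun_distVec`; multiplication by a unit permutes residue
  classes, `soloInformed_unit_mul_modEq_iff`) and the whole standard lattice `L_N` of
  `SoloInformedKubertWitness` (`soloInformed_sawFun_stdLattice`) — the easy half of the Koblitz–Ogus
  criterion, at every level `N`;
* INFLATION COMPATIBILITY (`soloInformed_sawFun_infl`): for `d ∣ n`, with `infl_d^n v = Σ_k v(k) e_{(n/d)k}`
  (`soloInformedInfl`, `soloInformedInflPt`, injective: `soloInformed_inflPt_injective`),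
  `λ_m(infl_d^n v) = λ_{m mod d}(v)`; hence (`soloInformed_sawFun_infl_lattices`) `λ_m` kills
  `infl_d^n V_lin(d)` and `infl_d^n L_d` as soon as `m mod d` is a unit of `ℤ/d` — even when `m` is NOT a
  unit of `ℤ/n`. This is (L2) of the paper's proof of (c6-ix)(B) for the functional `λ_h` (multiplier
  `p·h`, `h` a unit of `ℤ/(n/p)`) on inflations from the levels `d ∣ n` prime to `p`; (L1) is oddness
  plus the distribution relations of index `2` and `3`;
* SUMMARY `soloInformed_sawtoothFunctional_summary`.

Everything is for all levels; no `decide`.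
-/

namespace Summit.KontsevichZagierPeriods.KontsevichZagierPeriods.Theorems

open Finset

/-- `Σ_{j < d} j = d(d-1)/2` in `ℚ`. -/
theorem soloInformed_sum_range_cast (d : ℕ) :
    (∑ j ∈ range d, (j : ℚ)) * 2 = (d : ℚ) * ((d : ℚ) - 1) := by
  induction d with
  | zero => simp
  | succ n ih => rw [sum_range_succ, add_mul, ih]; push_cast; ring

/-- The residue class `{x ∈ ℤ/N : x ≡ r (mod M)}` (`M ∣ N`, `r < M`) is `{r + Mj : j < N/M}`. -/
theorem soloInformed_fiber_eq (N : ℕ) [NeZero N] {M : ℕ} (hM : M ∣ N) {r : ℕ} (hr : r < M) :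
    (univ.filter fun x : ZMod N => x.val % M = r) =
      (range (N / M)).image fun j => ((r + M * j : ℕ) : ZMod N) := by
  obtain ⟨d, hd⟩ := hM
  have hMpos : 0 < M := by omega
  have hdN : N / M = d := by rw [hd, Nat.mul_div_cancel_left _ hMpos]
  ext x
  simp only [mem_filter, mem_univ, true_and, mem_image, mem_range]
  constructor
  · intro hx
    refine ⟨x.val / M, ?_, ?_⟩
    · rw [hdN]
      have hlt : x.val < M * d := hd ▸ ZMod.val_lt x
      exact Nat.div_lt_of_lt_mul hlt
    · have hxv : r + M * (x.val / M) = x.val := by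
        have := Nat.div_add_mod x.val M; omega
      rw [hxv, ZMod.natCast_zmod_val]
  · rintro ⟨j, hj, rfl⟩
    rw [hdN] at hj
    have hlt : r + M * j < N := by
      rw [hd]; have : M * (j + 1) ≤ M * d := Nat.mul_le_mul_left _ hj; nlinarith
    rw [ZMod.val_natCast, Nat.mod_eq_of_lt hlt, Nat.add_mul_mod_self_left, Nat.mod_eq_of_lt hr]

/-- GAUSS'S DISTRIBUTION RELATION for the sawtooth, of every index `d = N/M`:
`Σ_{x ≡ y (mod M)} ((x/N)) = ((d·y/N))`. -/
theorem soloInformed_saw_distribution (N : ℕ) [NeZero N] {M : ℕ} (hM : M ∣ N) (y : ZMod N) :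
    ∑ x ∈ univ.filter (fun x : ZMod N => x.val % M = y.val % M), soloInformedSaw N x =
      soloInformedSaw N (((N / M : ℕ) : ZMod N) * y) := by
  obtain ⟨d, hd⟩ := hM
  have hNpos : 0 < N := Nat.pos_of_ne_zero (NeZero.ne N)
  have hMpos : 0 < M := by
    rcases Nat.eq_zero_or_pos M with h | h
    · rw [h, zero_mul] at hd; omega
    · exact h
  have hdpos : 0 < d := by
    rcases Nat.eq_zero_or_pos d with h | h
    · rw [h, mul_zero] at hd; omega
    · exact h
  have hdN : N / M = d := by rw [hd, Nat.mul_div_cancel_left _ hMpos]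
  set r := y.val % M with hr_def
  have hr : r < M := Nat.mod_lt _ hMpos
  rw [soloInformed_fiber_eq N ⟨d, hd⟩ hr, hdN]
  -- injectivity of the parametrisation on `range d`
  have hinj : Set.InjOn (fun j => ((r + M * j : ℕ) : ZMod N)) (range d) := by
    intro j₁ hj₁ j₂ hj₂ h
    simp only [coe_range, Set.mem_Iio] at hj₁ hj₂
    have h1 : r + M * j₁ < N := by rw [hd]; nlinarith
    have h2 : r + M * j₂ < N := by rw [hd]; nlinarith
    have hv := congrArg ZMod.val h
    simp only [ZMod.val_natCast, Nat.mod_eq_of_lt h1, Nat.mod_eq_of_lt h2] at hv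
    exact Nat.eq_of_mul_eq_mul_left hMpos (by omega : M * j₁ = M * j₂)
  rw [sum_image hinj]
  -- the value of each term
  have hterm : ∀ j ∈ range d, soloInformedSaw N ((r + M * j : ℕ) : ZMod N) =
      (((r + M * j : ℕ) : ℚ) / N - 1 / 2) + (if r = 0 ∧ j = 0 then 1 / 2 else 0) := by
    intro j hj
    rw [mem_range] at hj
    have hlt : r + M * j < N := by rw [hd]; nlinarith
    unfold soloInformedSaw
    have hval : ((r + M * j : ℕ) : ZMod N).val = r + M * j := by
      rw [ZMod.val_natCast, Nat.mod_eq_of_lt hlt]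
    have hzero : ((r + M * j : ℕ) : ZMod N) = 0 ↔ r = 0 ∧ j = 0 := by
      rw [← ZMod.val_eq_zero, hval]
      constructor
      · intro h
        have hMj : M * j = 0 := by omega
        rcases Nat.mul_eq_zero.mp hMj with h' | h'
        · omega
        · exact ⟨by omega, h'⟩
      · rintro ⟨h0, hj0⟩; simp [h0, hj0]
    by_cases h0 : r = 0 ∧ j = 0
    · rw [if_pos (hzero.mpr h0), if_pos h0]
      obtain ⟨h0r, h0j⟩ := h0
      simp [h0r, h0j]
    · rw [if_neg (fun h => h0 (hzero.mp h)), if_neg h0, hval]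
      ring
  rw [sum_congr rfl hterm, sum_add_distrib]
  -- the right-hand side
  have hdy : ((d : ℕ) : ZMod N) * y = ((d * r : ℕ) : ZMod N) := by
    have hy : y = ((y.val : ℕ) : ZMod N) := (ZMod.natCast_zmod_val y).symm
    have hdecomp : y.val = M * (y.val / M) + r := (Nat.div_add_mod y.val M).symm
    have hMd : ((M : ℕ) : ZMod N) * ((d : ℕ) : ZMod N) = 0 := by
      rw [← Nat.cast_mul, ← hd, ZMod.natCast_self]
    rw [hy, hdecomp]
    push_cast
    linear_combination ((y.val / M : ℕ) : ZMod N) * hMd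
  have hdr : d * r < N := by rw [hd]; nlinarith
  have hrhs : soloInformedSaw N (((d : ℕ) : ZMod N) * y) =
      (((d * r : ℕ) : ℚ) / N - 1 / 2) + (if r = 0 then 1 / 2 else 0) := by
    rw [hdy]
    unfold soloInformedSaw
    have hval : ((d * r : ℕ) : ZMod N).val = d * r := by rw [ZMod.val_natCast, Nat.mod_eq_of_lt hdr]
    by_cases h0 : r = 0
    · simp [h0]
    · have hne : ((d * r : ℕ) : ZMod N) ≠ 0 := by
        rw [ne_eq, ← ZMod.val_eq_zero, hval]; exact Nat.mul_ne_zero hdpos.ne' h0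
      rw [if_neg hne, if_neg h0, hval, add_zero]
  rw [hrhs]
  -- the correction terms
  have hcorr : ∑ j ∈ range d, (if r = 0 ∧ j = 0 then (1 / 2 : ℚ) else 0) =
      if r = 0 then 1 / 2 else 0 := by
    by_cases h0 : r = 0
    · simp only [h0, true_and, if_true]
      rw [sum_ite_eq' (range d) 0 (fun _ => (1 / 2 : ℚ))]
      simp [hdpos]
    · simp [h0]
  rw [hcorr]
  -- the linear terms
  have hlin : ∑ j ∈ range d, ((((r + M * j : ℕ) : ℚ)) / N - 1 / 2) = ((d * r : ℕ) : ℚ) / N - 1 / 2 := by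
    have hN : (N : ℚ) = M * d := by rw [hd]; push_cast; ring
    have hMne : (M : ℚ) ≠ 0 := by exact_mod_cast hMpos.ne'
    have hdne : (d : ℚ) ≠ 0 := by exact_mod_cast hdpos.ne'
    have hs := soloInformed_sum_range_cast d
    have hsum : ∑ j ∈ range d, (((r + M * j : ℕ) : ℚ)) = d * r + M * ∑ j ∈ range d, (j : ℚ) := by
      push_cast
      rw [sum_add_distrib, sum_const, card_range, nsmul_eq_mul, ← mul_sum]
    rw [sum_sub_distrib, ← sum_div, hsum, sum_const, card_range, nsmul_eq_mul, hN]
    push_cast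
    field_simp
    linear_combination (M : ℚ) * hs
  rw [hlin]

/-- Multiplication by a unit permutes residue classes modulo a divisor `M` of `N`:
`m x ≡ m y (mod M) ↔ x ≡ y (mod M)`. -/
theorem soloInformed_unit_mul_modEq_iff (N : ℕ) [NeZero N] {M : ℕ} (hM : M ∣ N) {m : ZMod N}
    (hm : IsUnit m) (x y : ZMod N) :
    (m * x).val % M = (m * y).val % M ↔ x.val % M = y.val % M := by
  obtain ⟨u, rfl⟩ := hm
  have hcop : (u : ZMod N).val.Coprime M :=
    Nat.Coprime.coprime_dvd_right hM (ZMod.val_coe_unit_coprime u)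
  rw [ZMod.val_mul, ZMod.val_mul, Nat.mod_mod_of_dvd _ hM, Nat.mod_mod_of_dvd _ hM]
  constructor
  · intro h
    exact Nat.ModEq.cancel_left_of_coprime (Nat.Coprime.symm hcop) h
  · intro h
    exact Nat.ModEq.mul_left _ h

/-- `λ_m` (unit `m`) annihilates every distribution vector `1_{x ≡ y (M)} - e_{(N/M)·y}`, `M ∣ N`:
Gauss's multiplication formula of index `N/M` is invisible to unit sawtooth functionals. -/
theorem soloInformed_sawFun_distVec (N : ℕ) [NeZero N] {m : ZMod N} (hm : IsUnit m) {M : ℕ}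
    (hM : M ∈ N.divisors) (y : ZMod N) :
    soloInformedSawFun N m (soloInformedDistVec N M y) = 0 := by
  have hMN : M ∣ N := Nat.dvd_of_mem_divisors hM
  rw [soloInformed_sawFun_apply]
  simp only [soloInformedDistVec, Int.cast_sub, Int.cast_ite, Int.cast_one, Int.cast_zero, sub_mul,
    ite_mul, one_mul, zero_mul, sum_sub_distrib, sum_ite_eq, mem_univ, if_true]
  rw [← sum_filter]
  -- transport the fibre sum along `x ↦ m x`
  obtain ⟨u, hu⟩ := hm
  have hbij : ∑ x ∈ univ.filter (fun x : ZMod N => x.val % M = y.val % M), soloInformedSaw N (m * x) =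
      ∑ x ∈ univ.filter (fun x : ZMod N => x.val % M = (m * y).val % M), soloInformedSaw N x := by
    refine sum_nbij' (fun x => m * x) (fun x => (↑u⁻¹ : ZMod N) * x) ?_ ?_ ?_ ?_ ?_
    · intro x hx
      simp only [mem_filter, mem_univ, true_and] at hx ⊢
      rwa [soloInformed_unit_mul_modEq_iff N hMN ⟨u, hu⟩]
    · intro x hx
      simp only [mem_filter, mem_univ, true_and] at hx ⊢
      have hmx : m * ((↑u⁻¹ : ZMod N) * x) = x := by
        rw [← hu, ← mul_assoc, Units.mul_inv, one_mul]
      rw [← soloInformed_unit_mul_modEq_iff N hMN ⟨u, hu⟩ (↑u⁻¹ * x) y, hmx]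
      exact hx
    · intro x _; simp [← hu, ← mul_assoc]
    · intro x _; simp [← hu, ← mul_assoc]
    · intro x _; rfl
  rw [hbij, soloInformed_saw_distribution N hMN (m * y), mul_left_comm, sub_self]

/-- LEVEL-FREE ANNIHILATION OF THE STANDARD LATTICE. Every unit sawtooth functional `λ_m` annihilates
the lattice `L_N` of standard relations (reflection + Gauss multiplication of every index dividing `N`)
of `SoloInformedKubertWitness`, at every level `N` (the easy half of the Koblitz–Ogus criterion). -/
theorem soloInformed_sawFun_stdLattice (N : ℕ) [NeZero N] {m : ZMod N} (hm : IsUnit m) :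
    ∀ v ∈ soloInformedStdLattice N, soloInformedSawFun N m v = 0 := by
  intro v hv
  have hgen : ∀ w ∈ soloInformedStdGen N, soloInformedSawFun N m w = 0 := by
    rintro w (⟨a, rfl⟩ | ⟨M, hM, y, rfl⟩)
    · exact soloInformed_sawFun_reflVec N m a
    · exact soloInformed_sawFun_distVec N hm hM y
  have h : soloInformedStdLattice N ≤ LinearMap.ker (soloInformedSawFun N m) :=
    Submodule.span_le.mpr fun w hw => LinearMap.mem_ker.mpr (hgen w hw)
  exact LinearMap.mem_ker.mp (h hv)

/-! ## Inflation from a divisor level: `λ_m ∘ infl_d^n = λ_{m mod d}` -/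

/-- The inflation of points `ψ : ℤ/d → ℤ/n`, `k ↦ (n/d)·k` (`d ∣ n`): `Γ(k/d) = Γ(((n/d)k)/n)`. -/
def soloInformedInflPt (d n : ℕ) (k : ZMod d) : ZMod n :=
  (((n / d) * k.val : ℕ) : ZMod n)

/-- Inflation of an exponent vector from level `d` to level `n` (`d ∣ n`):
`infl v = Σ_k v(k)·e_{(n/d)k}`. -/
def soloInformedInfl (d n : ℕ) [NeZero d] (v : ZMod d → ℤ) : ZMod n → ℤ :=
  fun x => ∑ k : ZMod d, if x = soloInformedInflPt d n k then v k else 0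

/-- `⟨ψ(k)⟩ = (n/d)·⟨k⟩`. -/
theorem soloInformed_inflPt_val (d n : ℕ) [NeZero d] [NeZero n] (hdn : d ∣ n) (k : ZMod d) :
    (soloInformedInflPt d n k).val = (n / d) * k.val := by
  obtain ⟨e, he⟩ := hdn
  have hdpos : 0 < d := Nat.pos_of_ne_zero (NeZero.ne d)
  have hepos : 0 < e := by
    rcases Nat.eq_zero_or_pos e with h | h
    · rw [h, mul_zero] at he; exact absurd he (NeZero.ne n)
    · exact h
  have hed : n / d = e := by rw [he, Nat.mul_div_cancel_left _ hdpos]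
  have hk := ZMod.val_lt k
  unfold soloInformedInflPt
  rw [ZMod.val_natCast, hed, Nat.mod_eq_of_lt]
  rw [he]; nlinarith

/-- `ψ` is injective. -/
theorem soloInformed_inflPt_injective (d n : ℕ) [NeZero d] [NeZero n] (hdn : d ∣ n) :
    Function.Injective (soloInformedInflPt d n) := by
  intro k₁ k₂ h
  have hv := congrArg ZMod.val h
  rw [soloInformed_inflPt_val d n hdn, soloInformed_inflPt_val d n hdn] at hv
  have hpos : 0 < n / d :=
    Nat.div_pos (Nat.le_of_dvd (Nat.pos_of_ne_zero (NeZero.ne n)) hdn) (Nat.pos_of_ne_zero (NeZero.ne d))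
  exact ZMod.val_injective d (Nat.eq_of_mul_eq_mul_left hpos hv)

/-- `(infl v)((n/d)k) = v(k)`. -/
theorem soloInformed_infl_apply_inflPt (d n : ℕ) [NeZero d] [NeZero n] (hdn : d ∣ n) (v : ZMod d → ℤ)
    (k : ZMod d) : soloInformedInfl d n v (soloInformedInflPt d n k) = v k := by
  unfold soloInformedInfl
  have h : ∀ k' : ZMod d, (if soloInformedInflPt d n k = soloInformedInflPt d n k' then v k' else 0) =
      if k = k' then v k' else 0 := by
    intro k'
    by_cases hk : k = k'
    · simp [hk]
    · rw [if_neg hk, if_neg (fun h => hk (soloInformed_inflPt_injective d n hdn h))]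
  simp only [h, sum_ite_eq, mem_univ, if_true]

/-- `infl v` vanishes off the image of `ψ`. -/
theorem soloInformed_infl_apply_of_forall_ne (d n : ℕ) [NeZero d] (v : ZMod d → ℤ) {x : ZMod n}
    (hx : ∀ k : ZMod d, x ≠ soloInformedInflPt d n k) : soloInformedInfl d n v x = 0 := by
  simp [soloInformedInfl, hx]

/-- The sawtooth of level `n` on an inflated point is the sawtooth of level `d`:
`((m·(n/d)k / n)) = (((m mod d)·k / d))`. -/
theorem soloInformed_saw_inflPt (d n : ℕ) [NeZero d] [NeZero n] (hdn : d ∣ n) (m : ZMod n) (k : ZMod d) :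
    soloInformedSaw n (m * soloInformedInflPt d n k) = soloInformedSaw d (((m.val : ℕ) : ZMod d) * k) := by
  have hψ := soloInformed_inflPt_val d n hdn k
  obtain ⟨e, he⟩ := hdn
  have hdpos : 0 < d := Nat.pos_of_ne_zero (NeZero.ne d)
  have hepos : 0 < e := by
    rcases Nat.eq_zero_or_pos e with h | h
    · rw [h, mul_zero] at he; exact absurd he (NeZero.ne n)
    · exact h
  have hed : n / d = e := by rw [he, Nat.mul_div_cancel_left _ hdpos]
  rw [hed] at hψ
  have key : ∀ a : ℕ, (e * a) % n = e * (a % d) := by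
    intro a; rw [he, mul_comm d e, Nat.mul_mod_mul_left]
  set j := (m.val * k.val) % d with hj
  have hval_n : (m * soloInformedInflPt d n k).val = e * j := by
    rw [ZMod.val_mul, hψ, show m.val * (e * k.val) = e * (m.val * k.val) by ring, key]
  have hval_d : ((((m.val : ℕ) : ZMod d)) * k).val = j := by
    rw [ZMod.val_mul, ZMod.val_natCast, Nat.mod_mul_mod]
  unfold soloInformedSaw
  by_cases h0 : j = 0
  · have hz1 : m * soloInformedInflPt d n k = 0 := by
      rw [← ZMod.val_eq_zero, hval_n, h0, mul_zero]
    have hz2 : (((m.val : ℕ) : ZMod d)) * k = 0 := by rw [← ZMod.val_eq_zero, hval_d, h0]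
    rw [if_pos hz1, if_pos hz2]
  · have hz1 : m * soloInformedInflPt d n k ≠ 0 := by
      rw [ne_eq, ← ZMod.val_eq_zero, hval_n]; exact Nat.mul_ne_zero hepos.ne' h0
    have hz2 : (((m.val : ℕ) : ZMod d)) * k ≠ 0 := by
      rw [ne_eq, ← ZMod.val_eq_zero, hval_d]; exact h0
    rw [if_neg hz1, if_neg hz2, hval_n, hval_d]
    have hn : (n : ℚ) = d * e := by rw [he]; push_cast; ring
    rw [hn]
    push_cast
    have hdq : (d : ℚ) ≠ 0 := by exact_mod_cast hdpos.ne'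
    have heq : (e : ℚ) ≠ 0 := by exact_mod_cast hepos.ne'
    field_simp

/-- INFLATION COMPATIBILITY. `λ_m(infl_d^n v) = λ_{m mod d}(v)`: a sawtooth functional of level `n`
restricted to vectors inflated from the divisor level `d` is the sawtooth functional of level `d` with
the reduced multiplier. -/
theorem soloInformed_sawFun_infl (d n : ℕ) [NeZero d] [NeZero n] (hdn : d ∣ n) (m : ZMod n)
    (v : ZMod d → ℤ) :
    soloInformedSawFun n m (soloInformedInfl d n v) = soloInformedSawFun d ((m.val : ℕ) : ZMod d) v := by
  rw [soloInformed_sawFun_apply, soloInformed_sawFun_apply]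
  simp only [soloInformedInfl, Int.cast_sum, Int.cast_ite, Int.cast_zero, sum_mul, ite_mul, zero_mul]
  rw [sum_comm]
  refine sum_congr rfl fun k _ => ?_
  simp only [sum_ite_eq', mem_univ, if_true]
  rw [soloInformed_saw_inflPt d n hdn m k]

/-- (L2) OF THE PAPER, LEVEL-FREE. If the multiplier `m ∈ ℤ/n` reduces to a UNIT of `ℤ/d` (`d ∣ n`;
e.g. `m = p·h` with `p ∤ d` and `h` a unit, although `m` itself is not a unit of `ℤ/n`), then `λ_m`
annihilates the inflation to level `n` of the whole two-term lattice `V_lin(d)` and of the standard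
lattice `L_d`. -/
theorem soloInformed_sawFun_infl_lattices (d n : ℕ) [NeZero d] [NeZero n] (hdn : d ∣ n) {m : ZMod n}
    (hm : IsUnit (((m.val : ℕ) : ZMod d))) :
    (∀ v ∈ soloInformedTwoTermLattice d, soloInformedSawFun n m (soloInformedInfl d n v) = 0) ∧
    (∀ v ∈ soloInformedStdLattice d, soloInformedSawFun n m (soloInformedInfl d n v) = 0) := by
  refine ⟨fun v hv => ?_, fun v hv => ?_⟩
  · rw [soloInformed_sawFun_infl d n hdn]; exact soloInformed_sawFun_twoTermLattice d hm v hv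
  · rw [soloInformed_sawFun_infl d n hdn]; exact soloInformed_sawFun_stdLattice d hm v hv

/-- SUMMARY (level-free kernel of main.md §7 (c6)(ix)(B)). At every level `N` and for every unit `m`:
`λ_m` kills the standard lattice `L_N` and the two-term lattice `V_lin(N)`, and evaluates a Beta symbol
to its CM-type bit minus `1/2`. -/
theorem soloInformed_sawtoothFunctional_summary (N : ℕ) [NeZero N] {m : ZMod N} (hm : IsUnit m) :
    (∀ v ∈ soloInformedStdLattice N, soloInformedSawFun N m v = 0) ∧
    (∀ v ∈ soloInformedTwoTermLattice N, soloInformedSawFun N m v = 0) ∧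
    (∀ a b : ZMod N, a ≠ 0 → b ≠ 0 → a + b ≠ 0 →
      soloInformedSawFun N m (soloInformedBetaVec N a b) = (soloInformedTauAt N a b m : ℚ) - 1 / 2) :=
  ⟨soloInformed_sawFun_stdLattice N hm, soloInformed_sawFun_twoTermLattice N hm,
    fun _ _ ha hb hab => soloInformed_sawFun_betaVec_eq_tau N hm ha hb hab⟩

end Summit.KontsevichZagierPeriods.KontsevichZagierPeriods.Theorems
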